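import Summits.Ventures.PercRepro.C041ZonePortCSCaseII
import Summits.Ventures.PercRepro.C041ZonePortCSAndDefs

/-!
# THEOREM R-CS with the validity `V_∧` — case (ii), a gate carrying both terminal types (p6, gen 28)

Setting of `C041ZonePortCSAndDefs`; the fibre argument of `C041ZonePortCSCaseII` verbatim for the validity `V_∧`
(reddening keeps `X₁ ∧ X₂`: `validAnd_redden`): `cs_fibre_and`, **`csAnd_of_twoType_gate`**.
-/

namespace PercRepro

namespace ZonePort

namespace Problem

open Finset CSCount

variable {V E : Type*}

/-- Reddening keeps the validity `V_∧`. -/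
theorem validAnd_redden [DecidableEq V] {P : Problem V E} {x : P.Term → Bool} (hx : P.ValidAnd x) (C : Finset V) :
    P.ValidAnd (P.redden C x) :=
  ⟨adm_redden hx.1 C, X₁_redden hx.2.1 C, X₂_redden hx.2.2 C⟩

section Fibres

variable [Fintype E] [DecidableEq E] [DecidableEq V] {P : Problem V E}

open Classical in
/-- The fibre of `r` among the valid patterns. -/
noncomputable def fibVAnd (P : Problem V E) (C : Finset V) (r : P.Term → Bool) : Finset (P.Term → Bool) :=
  P.validAndSet.filter fun x => P.redden C x = r

open Classical in
/-- The fibre of `r` among the valid `Good₁` patterns. -/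
noncomputable def fibG₁And (P : Problem V E) (C : Finset V) (r : P.Term → Bool) : Finset (P.Term → Bool) :=
  P.good₁AndSet.filter fun x => P.redden C x = r

open Classical in
/-- The fibre of `r` among the valid `Good₂` patterns. -/
noncomputable def fibG₂And (P : Problem V E) (C : Finset V) (r : P.Term → Bool) : Finset (P.Term → Bool) :=
  P.good₂AndSet.filter fun x => P.redden C x = r

/-- The valid patterns are the sum of the fibres. -/
theorem card_validAndSet_eq_sum_fibVAnd (C : Finset V) : #(P.validAndSet) = ∑ r, #(P.fibVAnd C r) := by
  classical
  exact card_eq_sum_card_fiberwise fun _ _ => Finset.mem_univ _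

/-- The valid `Good₁` patterns are the sum of the fibres. -/
theorem card_good₁AndSet_eq_sum_fibG₁And (C : Finset V) : #(P.good₁AndSet) = ∑ r, #(P.fibG₁And C r) := by
  classical
  exact card_eq_sum_card_fiberwise fun _ _ => Finset.mem_univ _

/-- The valid `Good₂` patterns are the sum of the fibres. -/
theorem card_good₂AndSet_eq_sum_fibG₂And (C : Finset V) : #(P.good₂AndSet) = ∑ r, #(P.fibG₂And C r) := by
  classical
  exact card_eq_sum_card_fiberwise fun _ _ => Finset.mem_univ _

/-- Membership in a valid fibre. -/
theorem mem_fibVAnd {C : Finset V} {r x : P.Term → Bool} : x ∈ P.fibVAnd C r ↔ P.ValidAnd x ∧ P.redden C x = r := by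
  classical
  unfold fibVAnd
  rw [Finset.mem_filter, mem_validAndSet]

/-- Membership in a `Good₁` fibre. -/
theorem mem_fibG₁And {C : Finset V} {r x : P.Term → Bool} :
    x ∈ P.fibG₁And C r ↔ (P.ValidAnd x ∧ P.Good₁ x) ∧ P.redden C x = r := by
  classical
  unfold fibG₁And
  rw [Finset.mem_filter, mem_good₁AndSet]

/-- Membership in a `Good₂` fibre. -/
theorem mem_fibG₂And {C : Finset V} {r x : P.Term → Bool} :
    x ∈ P.fibG₂And C r ↔ (P.ValidAnd x ∧ P.Good₂ x) ∧ P.redden C x = r := by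
  classical
  unfold fibG₂And
  rw [Finset.mem_filter, mem_good₂AndSet]

/-- **(CS) in every fibre** of the reddening map at a gate carrying both terminal types. -/
theorem cs_fibre_and {C : Finset V} (hC : P.IsGate C) {e₁ e₂ : P.Term} (he₁ : P.tz e₁.1 = C) (he₂ : P.tz e₂.1 = C)
    (hs₁ : P.ts e₁.1 = false) (hs₂ : P.ts e₂.1 = true) (r : P.Term → Bool) :
    CS #(P.fibVAnd C r) #(P.fibG₁And C r) #(P.fibG₂And C r) := by
  classical
  by_cases hne : (P.fibVAnd C r).Nonempty
  · obtain ⟨x₀, hx₀⟩ := hne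
    rw [mem_fibVAnd] at hx₀
    -- `r` is valid, all red at `C`, in its own fibre, Good on both sides
    have hrv : P.ValidAnd r := hx₀.2 ▸ validAnd_redden hx₀.1 C
    have hrr : P.redden C r = r := by
      rw [← hx₀.2, redden_redden]
    have hrR : P.AllRed C r := hx₀.2 ▸ allRed_redden C x₀
    have hr1 : r ∈ P.fibG₁And C r := mem_fibG₁And.2 ⟨⟨hrv, good₁_of_allRed hC he₂ hs₂ hrR⟩, hrr⟩
    have hr2 : r ∈ P.fibG₂And C r := mem_fibG₂And.2 ⟨⟨hrv, good₂_of_allRed hC he₁ hs₁ hrR⟩, hrr⟩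
    -- the fibre is covered by the two Good fibres and the two blue patterns
    have hcover : P.fibVAnd C r ⊆ P.fibG₁And C r ∪ P.fibG₂And C r ∪ {P.blue₁ C r, P.blue₂ C r} := by
      intro x hx
      rw [mem_fibVAnd] at hx
      by_cases h1 : P.Good₁ x
      · exact mem_union_left _ (mem_union_left _ (mem_fibG₁And.2 ⟨⟨hx.1, h1⟩, hx.2⟩))
      by_cases h2 : P.Good₂ x
      · exact mem_union_left _ (mem_union_right _ (mem_fibG₂And.2 ⟨⟨hx.1, h2⟩, hx.2⟩))
      apply mem_union_right
      rw [Finset.mem_insert, Finset.mem_singleton]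
      rcases eq_blue_of_not_good hC hx.1.1 h1 h2 with h | h
      · left
        rw [h, hx.2]
      · right
        rw [h, hx.2]
    have c1 : #(P.fibVAnd C r) ≤ #(P.fibG₁And C r ∪ P.fibG₂And C r ∪ {P.blue₁ C r, P.blue₂ C r}) := card_le_card hcover
    have c2 : #(P.fibG₁And C r ∪ P.fibG₂And C r ∪ {P.blue₁ C r, P.blue₂ C r}) ≤
        #(P.fibG₁And C r ∪ P.fibG₂And C r) + #({P.blue₁ C r, P.blue₂ C r} : Finset (P.Term → Bool)) :=
      card_union_le _ _
    have c3 : #({P.blue₁ C r, P.blue₂ C r} : Finset (P.Term → Bool)) ≤ 2 := card_le_two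
    have c4 : #(P.fibG₁And C r ∪ P.fibG₂And C r) + #(P.fibG₁And C r ∩ P.fibG₂And C r) = #(P.fibG₁And C r) + #(P.fibG₂And C r) :=
      card_union_add_card_inter _ _
    have c5 : 1 ≤ #(P.fibG₁And C r ∩ P.fibG₂And C r) := one_le_card.2 ⟨r, mem_inter.2 ⟨hr1, hr2⟩⟩
    have c6 : 1 ≤ #(P.fibG₁And C r) := one_le_card.2 ⟨r, hr1⟩
    have c7 : 1 ≤ #(P.fibG₂And C r) := one_le_card.2 ⟨r, hr2⟩
    have hd : #(P.fibVAnd C r) - #(P.fibG₁And C r) - #(P.fibG₂And C r) ≤ 1 := by omega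
    unfold CS
    calc (#(P.fibVAnd C r) - #(P.fibG₁And C r) - #(P.fibG₂And C r)) ^ 2 ≤ 1 ^ 2 := Nat.pow_le_pow_left hd 2
      _ = 1 * 1 := by norm_num
      _ ≤ #(P.fibG₁And C r) * #(P.fibG₂And C r) := Nat.mul_le_mul c6 c7
  · rw [Finset.not_nonempty_iff_eq_empty] at hne
    rw [hne, Finset.card_empty]
    exact cs_of_le (Nat.zero_le _)

/-- **Case (ii)**: a gate carrying both terminal types gives (CS) — fibre by fibre of the reddening map, then the
CAUCHY–SCHWARZ sum. -/
theorem csAnd_of_twoType_gate {C : Finset V} (hC : P.IsGate C) {e₁ e₂ : P.Term} (he₁ : P.tz e₁.1 = C)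
    (he₂ : P.tz e₂.1 = C) (hs₁ : P.ts e₁.1 = false) (hs₂ : P.ts e₂.1 = true) : P.CSAnd := by
  unfold CSAnd
  rw [card_validAndSet_eq_sum_fibVAnd C, card_good₁AndSet_eq_sum_fibG₁And C, card_good₂AndSet_eq_sum_fibG₂And C]
  exact cs_of_fibres _ _ _ _ fun r _ => cs_fibre_and hC he₁ he₂ hs₁ hs₂ r

end Fibres

end Problem

end ZonePort

end PercRepro
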